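import Summits.Schanuel.Schanuel.Theorems.ZilberEacDiagonalCriticalExistence
import HarnessLib

/-!
# O54 (b)'s critical equivariant base `x₂ = -(x₀ - x₁)² + x₀`: diagonal-ray solutions by the
# implicit function theorem at the nonlinear limit system

Zilber's Exponential-Algebraic Closedness, case ladder (host summit Schanuel, cell `pub-schanuel`,
seat 2, gen 13).  THE EXAMPLE left open in O53 (b) / O54 (b) / O55 (b):

  `W = {x₂ = -(x₀ - x₁)² + x₀,  y₀ = x₀ + y₂,  y₁ = x₁ + y₂} ⊆ ℂ³ × ℂ³`,

exponential points `e^{xⱼ} = xⱼ + e^{g(x)}`, `g(x) = -(x₀ - x₁)² + x₀`.  The base is EQUIVARIANT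
with drift `β = 1` (`g(x + z(1,1)) = g(x) + z`), so along the diagonal rays
`x = (2πipm + log m)(1,1) + v` the coupling is `e^{g(x)} = m·e^{g(v)}` — the CRITICAL size (gen 12:
"β = 1, no rotation AND critical: NOT covered").  Exactly as in `ZilberEacDiagonalCriticalExistence`
the rescaled system `e^{vⱼ} = 2πip + e^{g(v)} + ℓ + s vⱼ` (`s = 1/m`, `ℓ = log m/m`) is ENTIRE, its
limit is explicitly solvable (`v₁ = v₀ + 2πik`, `e^{v₀}(1 - e^{4π²k²}) = 2πip`, `k ≠ 0`), and the
Jacobian there has determinant `E·(E - G)(∂₀g + ∂₁g) = 2πip·E ≠ 0` because `∂₀g + ∂₁g = 1`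
(equivariance).

**`exists_solutions_equivariantCritical`.**  For `p ≠ 0` and every base solution `(v₀*, v₁*)` of
`e^{vⱼ*} = 2πip + e^{-(v₀*-v₁*)² + v₀*}` there are `v(m) → v*` with
`x(m) = (2πipm + log m)(1,1) + v(m)` solving `e^{xⱼ} = xⱼ + e^{-(x₀-x₁)² + x₀}` for all large `m`.
(The elimination is `ZilberEacEquivariantCriticalDensity`.)

HONEST FRAMING: an existence theorem for an explicit member of an OPEN cell (`ECCell 3 2`);
NOT Schanuel's conjecture; EAC ⇏ SC.
-/

noncomputable section

open Complex MvPolynomial Filter Topology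

set_option linter.dupNamespace false

namespace Summit.Schanuel.Schanuel.Theorems

section EquivariantCritical

/-- **THEOREM (diagonal-ray solutions over the critical equivariant base).**  See the module
docstring. (new) [cite: MantovaMasser2023, §1 p.5 (the open case dim π(V) = 2 in ℂ³×ℂˣ³)] -/
theorem exists_solutions_equivariantCritical {p : ℤ} (hp : p ≠ 0) {vs : ℂ × ℂ}
    (h0 : exp vs.1 = 2 * Real.pi * I * p + exp (-(vs.1 - vs.2) ^ 2 + vs.1))
    (h1 : exp vs.2 = 2 * Real.pi * I * p + exp (-(vs.1 - vs.2) ^ 2 + vs.1)) :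
    ∃ (x : ℕ → Fin 2 → ℂ) (v : ℕ → ℂ × ℂ), Tendsto v atTop (𝓝 vs) ∧
      (∀ m, x m 0 = 2 * Real.pi * I * p * m + Real.log m + (v m).1) ∧
      (∀ m, x m 1 = 2 * Real.pi * I * p * m + Real.log m + (v m).2) ∧
      (∀ᶠ m in atTop, ∀ j : Fin 2,
        exp (x m j) = x m j + exp (eval (x m) (-(X 0 - X 1) ^ 2 + X 0 : MvPolynomial (Fin 2) ℂ))) := by
  -- constants
  set P : ℂ := 2 * Real.pi * I * p with hP
  have hP0 : P ≠ 0 := mul_ne_zero Complex.two_pi_I_ne_zero (by exact_mod_cast hp)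
  -- the rescaled system
  set f : (ℂ × ℂ) × (ℂ × ℂ) → ℂ × ℂ := fun w =>
    (exp w.2.1 - P - exp (-((w.2.1 - w.2.2) * (w.2.1 - w.2.2)) + w.2.1) - w.1.2 - w.1.1 * w.2.1,
      exp w.2.2 - P - exp (-((w.2.1 - w.2.2) * (w.2.1 - w.2.2)) + w.2.1) - w.1.2 - w.1.1 * w.2.2)
    with hf
  have hfC : ContDiff ℂ 1 f := by
    rw [hf]
    fun_prop
  set G : ℂ := exp (-(vs.1 - vs.2) ^ 2 + vs.1) with hG
  have hGmul : exp (-((vs.1 - vs.2) * (vs.1 - vs.2)) + vs.1) = G := by rw [hG, sq]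
  have hfq : f (((0 : ℂ), (0 : ℂ)), vs) = 0 := by
    simp only [hf, Prod.mk_eq_zero, zero_mul, sub_zero, hGmul]
    constructor
    · rw [h0]; ring
    · rw [h1]; ring
  -- the partial derivative and its injectivity (`ga + gb = 1`: equivariance)
  set D : ℂ := vs.1 - vs.2 with hD
  set L : (ℂ × ℂ) →L[ℂ] (ℂ × ℂ) :=
    ((exp vs.1 - G * (1 - 2 * D)) • ContinuousLinearMap.fst ℂ ℂ ℂ -
        (G * (2 * D)) • ContinuousLinearMap.snd ℂ ℂ ℂ).prod
      (-(G * (1 - 2 * D)) • ContinuousLinearMap.fst ℂ ℂ ℂ +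
        (exp vs.2 - G * (2 * D)) • ContinuousLinearMap.snd ℂ ℂ ℂ) with hL
  have hLderiv : HasFDerivAt (fun q' : ℂ × ℂ => f (((0 : ℂ), (0 : ℂ)), q')) L vs := by
    have e : (fun q' : ℂ × ℂ => f (((0 : ℂ), (0 : ℂ)), q')) = fun q' =>
        (exp q'.1 - P - exp (-((q'.1 - q'.2) * (q'.1 - q'.2)) + q'.1),
          exp q'.2 - P - exp (-((q'.1 - q'.2) * (q'.1 - q'.2)) + q'.1)) := by
      funext q'
      simp only [hf, zero_mul, sub_zero]
    rw [e]
    have ha : HasFDerivAt (fun q' : ℂ × ℂ => q'.1) (ContinuousLinearMap.fst ℂ ℂ ℂ) vs :=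
      hasFDerivAt_fst
    have hb : HasFDerivAt (fun q' : ℂ × ℂ => q'.2) (ContinuousLinearMap.snd ℂ ℂ ℂ) vs :=
      hasFDerivAt_snd
    have hg := (((ha.sub hb).mul (ha.sub hb)).neg).add ha
    have c0 := (ha.cexp.sub_const P).sub hg.cexp
    have c1 := (hb.cexp.sub_const P).sub hg.cexp
    refine (c0.prodMk c1).congr_fderiv ?_
    rw [hL, hG, hD, sq]
    ext <;> simp <;> ring
  have hinj : Function.Injective L := by
    refine (injective_iff_map_eq_zero _).2 fun w hw => ?_
    have hw' : (exp vs.1 - G * (1 - 2 * D)) * w.1 - G * (2 * D) * w.2 = 0 ∧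
        -(G * (1 - 2 * D)) * w.1 + (exp vs.2 - G * (2 * D)) * w.2 = 0 := by
      rw [hL] at hw
      simpa [Prod.ext_iff] using hw
    obtain ⟨e0, e1⟩ := hw'
    have hE0 : exp vs.1 = P + G := by rw [h0]
    have hE1 : exp vs.2 = P + G := by rw [h1]
    rw [hE0] at e0
    rw [hE1] at e1
    have hPG : P + G ≠ 0 := by rw [← hE0]; exact Complex.exp_ne_zero _
    have hdiff : (P + G) * (w.1 - w.2) = 0 := by linear_combination e0 - e1
    have hw12 : w.1 = w.2 := sub_eq_zero.1 ((mul_eq_zero.1 hdiff).resolve_left hPG)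
    have hw1 : P * w.1 = 0 := by
      rw [← hw12] at e0
      linear_combination e0
    have hw1' : w.1 = 0 := (mul_eq_zero.1 hw1).resolve_left hP0
    exact Prod.ext hw1' (by rw [← hw12, hw1']; rfl)
  -- the implicit function and the solutions
  obtain ⟨ψ, hψsol, hψlim⟩ := exists_implicit_of_injective_partial hfC hfq hLderiv hinj
  set pr : ℕ → ℂ × ℂ := fun m => ((((1 / (m : ℝ) : ℝ)) : ℂ), (((Real.log m / (m : ℝ) : ℝ)) : ℂ))
    with hpr
  have hprt : Tendsto pr atTop (𝓝 ((0 : ℂ), (0 : ℂ))) := tendsto_inv_and_log_div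
  have hvlim : Tendsto (fun m => ψ (pr m)) atTop (𝓝 vs) := hψlim.comp hprt
  have hsol : ∀ᶠ m in atTop, f (pr m, ψ (pr m)) = 0 := hprt.eventually hψsol
  set x : ℕ → Fin 2 → ℂ := fun m =>
    ![2 * Real.pi * I * p * m + Real.log m + (ψ (pr m)).1,
      2 * Real.pi * I * p * m + Real.log m + (ψ (pr m)).2] with hx
  refine ⟨x, fun m => ψ (pr m), hvlim,
    fun m => by simp only [hx, Matrix.cons_val_zero, hP],
    fun m => by simp only [hx, Matrix.cons_val_one, Matrix.cons_val_zero, hP], ?_⟩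
  filter_upwards [hsol, eventually_ge_atTop 1] with m hm hm1
  have hmpos : (0 : ℝ) < (m : ℝ) := by exact_mod_cast hm1
  have hmC : (m : ℂ) ≠ 0 := by exact_mod_cast (show m ≠ 0 by omega)
  have hexpL : exp ((Real.log m : ℝ) : ℂ) = (m : ℂ) := by
    rw [← Complex.ofReal_exp, Real.exp_log hmpos]
    push_cast
    rfl
  have hexpP : exp (2 * Real.pi * I * p * m) = 1 := by
    have := Complex.exp_int_mul_two_pi_mul_I (p * m)
    rw [← this]; congr 1; push_cast; ring
  have hinv : (m : ℂ) * (1 / (m : ℂ)) = 1 := by field_simp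
  have hs : (((1 / (m : ℝ) : ℝ)) : ℂ) = 1 / (m : ℂ) := by push_cast; rfl
  have hl : (((Real.log m / (m : ℝ) : ℝ)) : ℂ) = ((Real.log m : ℝ) : ℂ) * (1 / (m : ℂ)) := by
    rw [Complex.ofReal_div]
    push_cast
    ring
  set Gm : ℂ := exp (-(((ψ (pr m)).1 - (ψ (pr m)).2) * ((ψ (pr m)).1 - (ψ (pr m)).2)) +
    (ψ (pr m)).1) with hGm
  -- the two rescaled equations
  have heq : exp (ψ (pr m)).1 = P + Gm + ((Real.log m : ℝ) : ℂ) * (1 / (m : ℂ)) +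
      1 / (m : ℂ) * (ψ (pr m)).1 ∧
      exp (ψ (pr m)).2 = P + Gm + ((Real.log m : ℝ) : ℂ) * (1 / (m : ℂ)) +
      1 / (m : ℂ) * (ψ (pr m)).2 := by
    have hpr1 : (pr m).1 = 1 / (m : ℂ) := by simp only [hpr]; exact hs
    have hpr2 : (pr m).2 = ((Real.log m : ℝ) : ℂ) * (1 / (m : ℂ)) := by simp only [hpr]; exact hl
    simp only [hf, Prod.mk_eq_zero] at hm
    rw [hpr1, hpr2] at hm
    obtain ⟨hm0, hm1'⟩ := hm
    exact ⟨by rw [hGm]; linear_combination hm0, by rw [hGm]; linear_combination hm1'⟩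
  obtain ⟨hq0, hq1⟩ := heq
  -- the base value along the solution
  have hbase : eval (x m) (-(X 0 - X 1) ^ 2 + X 0 : MvPolynomial (Fin 2) ℂ) =
      2 * Real.pi * I * p * m + ((Real.log m : ℝ) : ℂ) +
        (-(((ψ (pr m)).1 - (ψ (pr m)).2) * ((ψ (pr m)).1 - (ψ (pr m)).2)) + (ψ (pr m)).1) := by
    simp only [map_add, map_neg, map_pow, map_sub, eval_X, hx, Matrix.cons_val_zero,
      Matrix.cons_val_one]
    ring
  have hGexp : exp (2 * Real.pi * I * p * m + ((Real.log m : ℝ) : ℂ) +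
      (-(((ψ (pr m)).1 - (ψ (pr m)).2) * ((ψ (pr m)).1 - (ψ (pr m)).2)) + (ψ (pr m)).1)) =
      (m : ℂ) * Gm := by
    rw [Complex.exp_add (2 * Real.pi * I * p * m + ((Real.log m : ℝ) : ℂ)),
      Complex.exp_add (2 * Real.pi * I * p * m), hexpP, one_mul, hexpL]
  have hx0exp : exp (2 * Real.pi * I * p * m + ((Real.log m : ℝ) : ℂ) + (ψ (pr m)).1) =
      (m : ℂ) * exp (ψ (pr m)).1 := by
    rw [Complex.exp_add (2 * Real.pi * I * p * m + ((Real.log m : ℝ) : ℂ)),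
      Complex.exp_add (2 * Real.pi * I * p * m), hexpP, one_mul, hexpL]
  have hx1exp : exp (2 * Real.pi * I * p * m + ((Real.log m : ℝ) : ℂ) + (ψ (pr m)).2) =
      (m : ℂ) * exp (ψ (pr m)).2 := by
    rw [Complex.exp_add (2 * Real.pi * I * p * m + ((Real.log m : ℝ) : ℂ)),
      Complex.exp_add (2 * Real.pi * I * p * m), hexpP, one_mul, hexpL]
  intro j
  rw [hbase, hGexp]
  fin_cases j
  · simp only [hx, Fin.zero_eta, Matrix.cons_val_zero]
    rw [hx0exp, hq0, hP]
    push_cast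
    linear_combination (Complex.log ((m : ℕ) : ℂ) + (ψ (pr m)).1) * hinv
  · simp only [hx, Fin.mk_one, Matrix.cons_val_one, Matrix.cons_val_zero]
    rw [hx1exp, hq1, hP]
    push_cast
    linear_combination (Complex.log ((m : ℕ) : ℂ) + (ψ (pr m)).2) * hinv

end EquivariantCritical

end Summit.Schanuel.Schanuel.Theorems

end
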